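import Summits.CriticalPhenomena.PercolationContinuityZ3.Theorems.PercNearOneGluingNoHeavyLowerTailQ7PsiStarAll
import HarnessLib

/-!
# `NoHeavyLowerTail` (stmt-CriticalPhenomena-4575) — hypothesis-free MIN form of the peeled Question 7 on
# Kozma–Nitzan's Theorem-4 class

Support file (`--supports stmt-CriticalPhenomena-4575`), coupling seat `prim-cplus-coupling` (gen 5).  No
definitions, no named facts, no sorries.

* `Q7Psi.gpsi_star_min` — for the observer `o` attached only to the relays `A ∪ {z}` and EVERY monotone
  cluster property `F`, with no hypothesis on the means:
  `E[F(C o) − F(C z); o ↔ A] ≥ min(0, min_{a ∈ A} (E F(C a) − E F(C z)))`.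
  The same proof as `Q7Psi.gpsi_star` (seat memo A5-COUPLING-gen5.md §12–§13): if all off-`o` means of the
  strong relays dominate that of `z` the left side is `≥ 0`; otherwise it is `≥ Δᵢ` for the strong relay `i`
  with the least off-`o` mean.  The seat conjectures this min form for arbitrary observers (memo §13; LP
  evidence); on this class it is a theorem.
[cite: KozmaNitzan2024, Question 7 (p. 36), Theorem 4 and Lemma 5 (pp. 12–14), Lemma 3(ii) (pp. 6–7), §5.1 (pp. 31–32)]
-/

namespace Summit.CriticalPhenomena.PercolationContinuityZ3.Theorems

open MeasureTheory Set Literature.Probability.LatticeModels Literature.Probability.Percolation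
open scoped Classical
open KNPreFKG Q7Psi.Star

noncomputable section

namespace Q7Psi

variable {V : Type*} [Fintype V]

/-- **Hypothesis-free MIN form on Kozma–Nitzan's Theorem-4 class.**  With `Ψ := E[F(C o) − F(C z); o ↔ A]` and
`Δₐ := E F(C a) − E F(C z)`:  `Ψ ≥ min(0, minₐ Δₐ)`, stated as: every `c ≤ 0` with `c ≤ Δₐ` for all `a ∈ A`
satisfies `c ≤ Ψ`.  (`Q7Psi.gpsi_star` is the case `c = 0`.)
[cite: KozmaNitzan2024, Question 7 (p. 36), Theorem 4 and Lemma 5 (pp. 12–14), Lemma 3(ii) (pp. 6–7), §5.1 (pp. 31–32)] -/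
theorem gpsi_star_min (w : Sym2 V → unitInterval) (o z : V) (A : Finset V) (hoA : o ∉ A) (hzA : z ∉ A) (hzo : z ≠ o)
    (hiso : ∀ u, u ≠ o → u ∉ insert z A → w s(o, u) = 0)
    (F : Set V → ℝ) (hF : ∀ S T : Set V, S ⊆ T → F S ≤ F T) (c : ℝ) (hc0 : c ≤ 0)
    (hc : ∀ a ∈ A, c ≤ ∫ ω, F (openCluster ω a) ∂(prodBernoulli w) - ∫ ω, F (openCluster ω z) ∂(prodBernoulli w)) :
    c ≤ ∫ ω in (⋃ a ∈ A, openConn o a), F (openCluster ω o) ∂(prodBernoulli w) -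
      ∫ ω in (⋃ a ∈ A, openConn o a), F (openCluster ω z) ∂(prodBernoulli w) := by
  classical
  set μ := prodBernoulli w with hμ
  have hmeas : ∀ T : Set (BondConfig V), MeasurableSet T := fun _ => MeasurableSet.of_discrete
  have hint : ∀ (k : BondConfig V → ℝ) (T : Set (BondConfig V)), IntegrableOn k T μ :=
    fun k T => (Integrable.of_finite).integrableOn
  set J : Set (BondConfig V) := ⋃ a ∈ A, (openConn o a : Set (BondConfig V)) with hJ
  set f : BondConfig V → ℝ := fun ω => F (openCluster ω o) - F (openCluster ω z) with hf
  have hao : ∀ a ∈ A, a ≠ o := fun a ha h => hoA (h ▸ ha)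
  -- it suffices to show `0 ≤ Ψ := ∫_J f`
  have hΨ : ∫ ω in J, f ω ∂μ = ∫ ω in J, F (openCluster ω o) ∂μ - ∫ ω in J, F (openCluster ω z) ∂μ :=
    integral_sub (hint _ _) (hint _ _)
  rw [← hΨ]
  -- partition along the stars of `o`
  have ho : o ∉ insert z A := by simp [hzo.symm, hoA]
  have hsumJ := setIntegral_eq_sum_inter_starEvent w (insert z A) o ho hiso J f
  -- the off-`o` means
  set α : V → ℝ := fun a => ∫ ω, (F {v | ω ∈ openConnIn ({o}ᶜ : Set V) a v} -
    F {v | ω ∈ openConnIn ({o}ᶜ : Set V) z v}) ∂μ with hα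
  have hαle : ∀ a c : V, α a ≤ α c → ∫ ω, F {v | ω ∈ openConnIn ({o}ᶜ : Set V) a v} ∂μ ≤
      ∫ ω, F {v | ω ∈ openConnIn ({o}ᶜ : Set V) c v} ∂μ := by
    intro a c h
    simp only [hα] at h
    rw [integral_sub (Integrable.of_finite) (Integrable.of_finite), integral_sub (Integrable.of_finite) (Integrable.of_finite)] at h
    linarith
  have hα0 : ∀ a : V, 0 ≤ α a ↔ ∫ ω, F {v | ω ∈ openConnIn ({o}ᶜ : Set V) z v} ∂μ ≤
      ∫ ω, F {v | ω ∈ openConnIn ({o}ᶜ : Set V) a v} ∂μ := by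
    intro a
    simp only [hα]
    rw [integral_sub (Integrable.of_finite) (Integrable.of_finite)]
    constructor <;> intro h <;> linarith
  -- facts about a star `B ⊆ insert z A`
  have hBo : ∀ B ∈ (insert z A).powerset, ∀ u ∈ (↑B : Set V), u ≠ o := by
    intro B hB u hu h
    have := Finset.mem_powerset.1 hB (Finset.mem_coe.1 hu)
    exact ho (h ▸ this)
  -- (1) stars containing `z` or empty: `∫_{J∩σ_B} f = 0`; other stars: `J ∩ σ_B = σ_B`
  have hTz : ∀ B : Finset V, z ∈ B → ∫ ω in J ∩ starEvent o ↑B, f ω ∂μ = 0 := by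
    intro B hzB
    rw [setIntegral_congr_fun (hmeas _) (g := fun _ => (0 : ℝ)) fun ω hω => ?_]
    · simp
    · exact psiIntegrand_z F hω.2 (Finset.mem_coe.2 hzB) hzo
  have hTempty : ∫ ω in J ∩ starEvent o ↑(∅ : Finset V), f ω ∂μ = 0 := by
    have : J ∩ starEvent o ↑(∅ : Finset V) = ∅ := by
      ext ω
      simp only [hJ, mem_inter_iff, mem_iUnion, exists_prop, mem_empty_iff_false, iff_false, not_and]
      rintro ⟨a, ha, hoa⟩ hσ
      rw [Finset.coe_empty] at hσ
      exact not_reachable_of_empty hσ (hao a ha) hoa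
    rw [this, setIntegral_empty]
  have hJB : ∀ B ∈ (insert z A).powerset, z ∉ B → B ≠ ∅ → J ∩ starEvent o ↑B = starEvent o ↑B := by
    intro B hB hzB hne
    obtain ⟨j, hj⟩ := Finset.nonempty_iff_ne_empty.2 hne
    have hjA : j ∈ A := by
      have := Finset.mem_powerset.1 hB hj
      rcases Finset.mem_insert.1 this with h | h
      · exact absurd (h ▸ hj) hzB
      · exact h
    refine inter_eq_right.2 fun ω hσ => mem_iUnion₂.2 ⟨j, hjA, ?_⟩
    exact (openCluster_x_of_mem hσ (Finset.mem_coe.2 hj) (hao j hjA)).2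
  by_cases hall : ∀ a ∈ A, 0 ≤ α a
  · -- CASE 1: all off-`o` means of the strong relays dominate that of `z`: every star term is `≥ 0`
    refine hc0.trans ?_
    rw [hsumJ]
    refine Finset.sum_nonneg fun B hB => ?_
    by_cases hzB : z ∈ B
    · rw [hTz B hzB]
    by_cases hne : B = ∅
    · subst hne; rw [hTempty]
    obtain ⟨j, hj⟩ := Finset.nonempty_iff_ne_empty.2 hne
    have hjA : j ∈ A := by
      have := Finset.mem_powerset.1 hB hj
      rcases Finset.mem_insert.1 this with h | h
      · exact absurd (h ▸ hj) hzB
      · exact h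
    rw [hJB B hB hzB hne]
    calc (0 : ℝ) ≤ ∫ ω in starEvent o ↑B, {ω' : BondConfig V | ∀ u ∈ (↑B : Set V), u ≠ o →
            ω' ∉ openConnIn ({o}ᶜ : Set V) z u}.indicator
          (fun ω' => F {v | ω' ∈ openConnIn ({o}ᶜ : Set V) j v} - F {v | ω' ∈ openConnIn ({o}ᶜ : Set V) z v}) ω ∂μ :=
          star_integral_nonneg w o z j hzo (hao j hjA) ↑B F hF ((hα0 j).1 (hall j hjA))
      _ ≤ ∫ ω in starEvent o ↑B, f ω ∂μ :=
          setIntegral_mono_on (hint _ _) (hint _ _) (hmeas _) fun ω hσ =>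
            star_diff_ge F hF hσ (Finset.mem_coe.2 hj) (hao j hjA) hzo
  · -- CASE 2: some strong relay has a smaller off-`o` mean than `z`; take `i` with the least mean
    push Not at hall
    obtain ⟨i₀, hi₀A, hi₀⟩ := hall
    obtain ⟨i, hiA, himin⟩ := A.exists_min_image α ⟨i₀, hi₀A⟩
    have hαi : α i ≤ 0 := (himin i₀ hi₀A).trans hi₀.le
    have hαiz : α i ≤ α z := by
      have hz0 : α z = 0 := by simp only [hα, sub_self, integral_zero]
      rw [hz0]; exact hαi
    have hio : i ≠ o := hao i hiA
    have hiz : i ≠ z := fun h => hzA (h ▸ hiA)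
    -- `Δ_i ≥ 0`, partitioned along the same stars
    set d : BondConfig V → ℝ := fun ω => F (openCluster ω i) - F (openCluster ω z) with hd
    have hΔ : c ≤ ∫ ω, d ω ∂μ := by
      simp only [hd]; rw [integral_sub (Integrable.of_finite) (Integrable.of_finite)]; exact hc i hiA
    have hsumD := setIntegral_eq_sum_inter_starEvent w (insert z A) o ho hiso univ d
    simp only [univ_inter] at hsumD
    rw [setIntegral_univ] at hsumD
    -- termwise `∫_{J∩σ_B} f - ∫_{σ_B} d ≥ 0`
    have hterm : ∀ B ∈ (insert z A).powerset,
        ∫ ω in starEvent o ↑B, d ω ∂μ ≤ ∫ ω in J ∩ starEvent o ↑B, f ω ∂μ := by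
      intro B hB
      by_cases hzB : z ∈ B
      · -- stars containing `z`
        rw [hTz B hzB]
        calc ∫ ω in starEvent o ↑B, d ω ∂μ
            ≤ ∫ ω in starEvent o ↑B, {ω' : BondConfig V | ∀ u ∈ (↑B : Set V), u ≠ o →
                ω' ∉ openConnIn ({o}ᶜ : Set V) i u}.indicator
              (fun ω' => F {v | ω' ∈ openConnIn ({o}ᶜ : Set V) i v} - F {v | ω' ∈ openConnIn ({o}ᶜ : Set V) z v}) ω ∂μ :=
              setIntegral_mono_on (hint _ _) (hint _ _) (hmeas _) fun ω hσ =>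
                star_diff_le F hF hσ (Finset.mem_coe.2 hzB) hzo hio
          _ ≤ 0 := by
              have h := star_integral_nonneg w o i z hio hzo ↑B F hF (hαle i z hαiz)
              rw [← neg_nonneg, ← integral_neg]
              refine le_trans h (le_of_eq ?_)
              refine integral_congr_ae (Filter.Eventually.of_forall fun ω => ?_)
              simp only [Set.indicator_apply, mem_setOf_eq]
              split_ifs <;> ring
      by_cases hne : B = ∅
      · -- the empty star: `o` isolated, `d = F(X'_i) - F(Z')` off `o`
        subst hne
        rw [hTempty]
        have e : ∫ ω in starEvent o ↑(∅ : Finset V), d ω ∂μ = ∫ ω in starEvent o ↑(∅ : Finset V),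
            {ω' : BondConfig V | ∀ u ∈ (↑(∅ : Finset V) : Set V), u ≠ o → ω' ∉ openConnIn ({o}ᶜ : Set V) i u}.indicator
              (fun ω' => F {v | ω' ∈ openConnIn ({o}ᶜ : Set V) i v} - F {v | ω' ∈ openConnIn ({o}ᶜ : Set V) z v}) ω ∂μ := by
          refine setIntegral_congr_fun (hmeas _) fun ω hσ => ?_
          have hmem : ω ∈ {ω' : BondConfig V | ∀ u ∈ (↑(∅ : Finset V) : Set V), u ≠ o →
              ω' ∉ openConnIn ({o}ᶜ : Set V) i u} := by
            intro u hu; simp at hu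
          rw [indicator_of_mem hmem, hd]
          rw [Finset.coe_empty] at hσ
          exact diffIntegrand_empty F hσ hio hzo
        rw [e]
        have h := star_integral_nonneg w o i z hio hzo ↑(∅ : Finset V) F hF (hαle i z hαiz)
        rw [← neg_nonneg, ← integral_neg]
        refine le_trans h (le_of_eq ?_)
        refine integral_congr_ae (Filter.Eventually.of_forall fun ω => ?_)
        simp only [Set.indicator_apply, mem_setOf_eq]
        split_ifs <;> ring
      -- nonempty stars of strong relays
      rw [hJB B hB hzB hne]
      by_cases hiB : i ∈ B
      · -- stars containing `i`: `C(i) = C(o)`, the two integrands agree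
        refine le_of_eq (setIntegral_congr_fun (hmeas _) fun ω hσ => ?_)
        simp only [hd, hf, (openCluster_x_of_mem hσ (Finset.mem_coe.2 hiB) hio).1]
      · obtain ⟨j, hj⟩ := Finset.nonempty_iff_ne_empty.2 hne
        have hjA : j ∈ A := by
          have := Finset.mem_powerset.1 hB hj
          rcases Finset.mem_insert.1 this with h | h
          · exact absurd (h ▸ hj) hzB
          · exact h
        have hij : α i ≤ α j := himin j hjA
        rw [← sub_nonneg, ← integral_sub (hint _ _) (hint _ _)]
        calc (0 : ℝ) ≤ ∫ ω in starEvent o ↑B, {ω' : BondConfig V | ∀ u ∈ (↑B : Set V), u ≠ o →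
                ω' ∉ openConnIn ({o}ᶜ : Set V) i u}.indicator
              (fun ω' => F {v | ω' ∈ openConnIn ({o}ᶜ : Set V) j v} - F {v | ω' ∈ openConnIn ({o}ᶜ : Set V) i v}) ω ∂μ :=
              star_integral_nonneg w o i j hio (hao j hjA) ↑B F hF (hαle i j hij)
          _ ≤ ∫ ω in starEvent o ↑B, (f ω - d ω) ∂μ :=
              setIntegral_mono_on (hint _ _) (hint _ _) (hmeas _) fun ω hσ => by
                have h := star_diff_ge F hF hσ (Finset.mem_coe.2 hj) (hao j hjA) hio
                simp only [hf, hd]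
                linarith
    rw [hsumJ]
    calc c ≤ ∫ ω, d ω ∂μ := hΔ
      _ = ∑ B ∈ (insert z A).powerset, ∫ ω in starEvent o ↑B, d ω ∂μ := hsumD
      _ ≤ ∑ B ∈ (insert z A).powerset, ∫ ω in J ∩ starEvent o ↑B, f ω ∂μ := Finset.sum_le_sum hterm

end Q7Psi

end

end Summit.CriticalPhenomena.PercolationContinuityZ3.Theorems
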